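import Literature.MathematicalPhysics.QuantumFieldTheory.Balaban1983to89.B12Eq213GaussianLastCoupling
import Literature.MathematicalPhysics.QuantumFieldTheory.Balaban1983to89.B12Eq213SecondOrderCoupling

/-!
# `Balaban1983to89.B12Eq213GaussianSecondOrder` — T. Bałaban, *Renormalization group approach to lattice gauge field theories. I*,
Commun. Math. Phys. **109** (1987) 249–301 [Balaban1987RG1], (2.13) p. 268 with p. 263 ll. 22–28 / p. 264, and [Balaban1988RG2Cluster]
(2.20), (2.25) pp. 16–17: **p. 263's clause AT SECOND ORDER WITH A GAUSSIAN MODULUS — the variance formula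
`∂²_g 𝐄^{(k+1)} = ⟨∂²_g F⟩ + ⟨(∂_g F)²⟩ − ⟨∂_g F⟩²` under (2.20)-type DOMINATIONS (not uniform bounds) of `F = 𝐏^{(k)} + {…}` and its
first two `g`-derivatives by quadratic forms on the small-field support, and the explicit bound of `|∂²_g 𝐄^{(k+1)}|` by tilted
Gaussian moments ((2.25) at general precision) over the damped small-field mass; kernel-checked on the body of record**

statement-level skeleton of published theorems with citation tags; proofs where landed; nothing here is a claim about
the Yang–Mills mass gap

PDF held: `paper:balaban1987-cmp109-rg-i-small-field` (journal page = PDF page + 248); pp. 263–264, 268 re-read this session;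
[II] = `paper:balaban1988-cmp116-rg-ii-cluster` pp. 16–17 as quoted in `B12Eq213GaussianTiltedMoments`.

CITATION HEADER / WHAT IS REPRODUCED (cell `pub-ymgap`, HUMAN RULING D-0062 Track A, seat `pub-ymgap-dag-n22-b` = the
FIRST-MISSING-ESTIMATE seat of DAG node N22 = NE9; twelfth module of the body-level chain: the Gaussian-currency completion of
`B12Eq213SecondOrderCoupling` (uniform currency) — the twin seat's map [DAGN22A-G0-COORD-1] (pub-ymgap INBOX l.9434) names exactly
this: *«(S2-last) … ∂²_g log∫ = ⟨∂²_g F⟩_tilted + Var_tilted(∂_g F), i.e. your tilted-expectation currency ONE ORDER UP plus a tilted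
VARIANCE (bounded by a tilted second moment)»*; a NEW LEAF over `B12Eq213GaussianLastCoupling` (p410755 / v1.1 p411393),
`B12Eq213GaussianTiltedMoments` (p410261), `B12Eq213SecondOrderCoupling` (p413275 / v1.1), `B12Eq213CouplingDependence` (p409146 /
v1.1 p409833); nothing there modified).

THE PRINT.  p. 263 ll. 22–28: *«It is a C^∞-function of g_{j−1} ∈ [0, γ], (or analytic)»*; p. 264: *«uniformly bounded on this interval
together with all derivatives»*; (2.13) p. 268; [II] (2.20) `|𝐏^{(k),j}_{X,i}(g_k, B)| ≦ O(1) exp(−κd_k(X))`, (2.25) the quadratic exponential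
moment.  NOTHING quantitative about `∂²_g 𝐄^{(k+1)}` is printed.

WHAT THIS MODULE DOES (THEOREMS ONLY; no definition, no named fact):
* (the general-datum DOMINATED currency — `hasDerivAt_firstMoment_of_dominated`, `hasDerivAt_derivNewTerm_of_dominated` (variance formula),
  `abs_secondDeriv_le_tilted` — is `B12Eq213SecondOrderCoupling` §4 (v1.1); this module is its Gaussian instance:)
* (GAUSSIAN datum `FluctData.gaussian`): **`abs_secondDeriv_newTerm_gaussian_le`** — under `|F| ≤ a₀ + ½α|B|²`, `|∂_gF| ≤ m₀ + ½m₂|B|²`,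
  `|∂²_gF| ≤ n₀ + ½n₂|B|²` on the support of `χ_U` along a coupling ball, `M − α·1` and `M − (α+δ)·1` positive definite, positive damped
  small-field mass `mass = ∫χ_U e^{−½α|B|²}dμ_{M⁻¹}`: the first derivative of `g ↦ 𝐄^{(k+1)}(g,U)` is differentiable at `g₀` (variance
  formula) and, with `R(c) = √(det M ∕ det(M − c·1))`,
  `|∂²_g 𝐄^{(k+1)}(g₀,U)| ≤ e^{2a₀}((n₀ + 2m₀²)R(α) + (n₂∕δ + 4m₂²∕δ²)R(α+δ))∕mass + (e^{2a₀}(m₀R(α) + (m₂∕δ)R(α+δ))∕mass)²`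
  (the square `(m₀ + ½m₂|B|²)² ≤ 2m₀² + ½m₂²|B|⁴` and `|B|⁴ ≤ 8δ⁻²e^{½δ|B|²}` reduce the quartic moment to (2.25)).
HONEST READING: body level at fixed finite volume (the `R(c)` are volume-dependent, see `B12Eq213GaussianSmallFieldMass`); the dominations
are displayed ((2.12)'s explicit `𝐏^{(k)}` + (1.17) ∘ the substitution = `B12Eq212BracketCoupling`); localization absent (W1).

HONEST FRAMING: count-neutral Track-A side module; NOT a discharge of node N22; one finite T⁴ programme at fixed ε, Bałaban AS PRINTED with
locators; nothing continuum ∕ ℝ⁴ ∕ OS ∕ mass-gap ∕ Clay.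

v1.1 (APPEND-ONLY, seat gen 2; §1 byte-identical): §2 **`abs_secondDiff_newTerm_gaussian_le`** — the second-DIFFERENCE letter (B2) with the
same Gaussian modulus: on a coupling ball carrying §1's hypotheses at every point, the first derivative of the new term is `K`-Lipschitz
(`K` = §1's bound, uniform on the ball; mean value) and hence `|𝐄^{(k+1)}(t+d, U) − 2𝐄^{(k+1)}(t, U) + 𝐄^{(k+1)}(t−d, U)| ≤ K·d²` (Taylor at
second order in difference form) — the shape `hB2` the node's history towers display (dag-ref-B READ-218: «READ #211's second derivative
bound needs a Taylor ∕ mean-value step on the window to become (B2)»), here supplied.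
-/

noncomputable section

namespace Literature.MathematicalPhysics.QuantumFieldTheory.Balaban1983to89.B12Eq213GaussianSecondOrder

open _root_.MeasureTheory Matrix
open scoped BigOperators
open Literature.MathematicalPhysics.QuantumFieldTheory.Balaban1983to89
open Literature.MathematicalPhysics.QuantumFieldTheory.Balaban1983to89.B12Eq213Body268 (FluctData)
open Literature.MathematicalPhysics.QuantumFieldTheory.Balaban1983to89.B13GaugeDevices (gaussWeight)
open Literature.MathematicalPhysics.QuantumFieldTheory.Balaban1983to89.B2Eq228Conditioning (gaussProb integrable_gaussWeight)
open Literature.MathematicalPhysics.QuantumFieldTheory.Balaban1983to89.B12Eq213CouplingDependence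
open Literature.MathematicalPhysics.QuantumFieldTheory.Balaban1983to89.B12Eq213GaussianTiltedMoments
open Literature.MathematicalPhysics.QuantumFieldTheory.Balaban1983to89.B12Eq213GaussianLastCoupling
open Literature.MathematicalPhysics.QuantumFieldTheory.Balaban1983to89.B12Eq213SecondOrderCoupling

/-! ## Second order for the Gaussian datum: explicit tilted Gaussian moments -/

section Gaussian

variable {X : Type*} {κ : Type} [Fintype κ] [DecidableEq κ]
variable (prec : X → Matrix κ κ ℝ) (hpd : ∀ U, (prec U).PosDef) (χ : X → (κ → ℝ) → ℝ) (h0 : ∀ U B, 0 ≤ χ U B)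
  (h1 : ∀ U B, χ U B ≤ 1) (P Q : ℝ → X → (κ → ℝ) → ℝ)

omit [DecidableEq κ] in
/-- `x ≤ (2∕δ)e^{½δx}` for `x = |B|² ≥ 0`. [folklore] -/
private theorem sq_le_exp_sq'' {δ : ℝ} (hδ : 0 < δ) (x : κ → ℝ) :
    x ⬝ᵥ x ≤ 2 / δ * Real.exp (δ / 2 * (x ⬝ᵥ x)) := by
  have h := Real.add_one_le_exp (δ / 2 * (x ⬝ᵥ x))
  have hx : 0 ≤ x ⬝ᵥ x := Finset.sum_nonneg fun i _ => mul_self_nonneg (x i)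
  rw [div_mul_eq_mul_div, le_div_iff₀ hδ]
  nlinarith

omit [DecidableEq κ] in
/-- `x² ≤ (8∕δ²)e^{½δx}` for `x = |B|² ≥ 0` (from `e^{t} ≥ 1 + t + t²∕2 ≥ t²∕2`, `t = ½δx`). [folklore] -/
private theorem sq_sq_le_exp_sq {δ : ℝ} (hδ : 0 < δ) (x : κ → ℝ) :
    (x ⬝ᵥ x) ^ 2 ≤ 8 / δ ^ 2 * Real.exp (δ / 2 * (x ⬝ᵥ x)) := by
  have hx : 0 ≤ x ⬝ᵥ x := Finset.sum_nonneg fun i _ => mul_self_nonneg (x i)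
  have ht : 0 ≤ δ / 2 * (x ⬝ᵥ x) := by positivity
  have h := Real.quadratic_le_exp_of_nonneg ht
  -- h : 1 + t + t²/2 ≤ e^t
  rw [div_mul_eq_mul_div, le_div_iff₀ (by positivity)]
  nlinarith [h, sq_nonneg (x ⬝ᵥ x)]

omit [DecidableEq κ] in
/-- The two-exponential majorant `e^{a₀}(c₁e^{½α|B|²} + c₂e^{½(α+δ)|B|²})` is `gaussProb M`-integrable when `M − α·1` and `M − (α+δ)·1`
are positive definite (plumbing for the dominations; as in `B12Eq213GaussianLastCoupling`). [folklore] -/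
private theorem integrable_majorant₂ {M : Matrix κ κ ℝ} [DecidableEq κ] (hM : M.PosDef) {α δ : ℝ} (a₀ c₁ c₂ : ℝ)
    (hMα : (M - α • (1 : Matrix κ κ ℝ)).PosDef) (hMδ : (M - (α + δ) • (1 : Matrix κ κ ℝ)).PosDef) :
    Integrable (fun B : κ → ℝ => Real.exp a₀ * (c₁ * Real.exp (α / 2 * (B ⬝ᵥ B))
      + c₂ * Real.exp ((α + δ) / 2 * (B ⬝ᵥ B)))) (gaussProb M) := by
  rw [integrable_gaussProb_iff hM]
  have hI1 : Integrable (fun B : κ → ℝ => gaussWeight M B * Real.exp (α / 2 * (B ⬝ᵥ B))) := by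
    refine (integrable_gaussWeight hMα).congr (Filter.Eventually.of_forall fun B => ?_)
    simp only [← gaussWeight_mul_exp_sq]
  have hI2 : Integrable (fun B : κ → ℝ => gaussWeight M B * Real.exp ((α + δ) / 2 * (B ⬝ᵥ B))) := by
    refine (integrable_gaussWeight hMδ).congr (Filter.Eventually.of_forall fun B => ?_)
    simp only [← gaussWeight_mul_exp_sq]
  have h := ((hI1.const_mul c₁).add (hI2.const_mul c₂)).const_mul (Real.exp a₀)
  refine h.congr (Filter.Eventually.of_forall fun B => ?_)
  simp only [Pi.add_apply]
  ring

/-- **p. 263's CLAUSE AT SECOND ORDER WITH A GAUSSIAN MODULUS.**  At the Gaussian datum of (2.13) (measures `gaussProb (prec U)`), let the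
exponent `F = 𝐏^{(k)} + {…}` be twice `g`-differentiable along the coupling ball `|g − g₀| < ε` for every `B` in the support of `χ_U`, with
derivatives `e′`, `e″` and the (2.20)-type dominations `|F| ≤ a₀ + ½α|B|²`, `|e′| ≤ m₀ + ½m₂|B|²`, `|e″| ≤ n₀ + ½n₂|B|²` there
(`m₀, m₂, n₀, n₂ ≥ 0`, `δ > 0`); let `M − α·1`, `M − (α+δ)·1` be positive definite (`M = prec U`), the damped small-field mass
`mass = ∫ χ_U e^{−½α|B|²} dμ_{M⁻¹}` positive, and the integrands ∕ derivatives measurable.  Then the first derivative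
`g ↦ (∫χe^{F})⁻¹∫χe^{F}e′` of `g ↦ 𝐄^{(k+1)}(g, U)` is differentiable at `g₀` with derivative `⟨e″ + e′²⟩ − ⟨e′⟩²` (variance formula), and
with `R(c) = √(det M ∕ det(M − c·1))`:
`|∂²_g 𝐄^{(k+1)}(g₀,U)| ≤ e^{2a₀}((n₀ + 2m₀²)R(α) + (n₂∕δ + 4m₂²∕δ²)R(α+δ))∕mass + (e^{2a₀}(m₀R(α) + (m₂∕δ)R(α+δ))∕mass)²`.
[cite: Balaban1987RG1, (2.13) p.268, p.263 (clause before (1.18)) and p.264; Balaban1988RG2Cluster, (2.20) p.16 and (2.25) p.17] -/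
theorem abs_secondDeriv_newTerm_gaussian_le {U : X} {g₀ ε a₀ α δ m₀ m₂ n₀ n₂ : ℝ} (e' e'' : ℝ → (κ → ℝ) → ℝ) (hε : 0 < ε)
    (hm₀ : 0 ≤ m₀) (hm₂ : 0 ≤ m₂) (hn₀ : 0 ≤ n₀) (hn₂ : 0 ≤ n₂) (hδ : 0 < δ)
    (hmeas : ∀ g ∈ Metric.ball g₀ ε,
      AEStronglyMeasurable (fun B => χ U B * Real.exp (P g U B + Q g U B)) (gaussProb (prec U)))
    (hmeas' : ∀ g ∈ Metric.ball g₀ ε, AEStronglyMeasurable (e' g) (gaussProb (prec U)))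
    (hmeas'' : AEStronglyMeasurable (e'' g₀) (gaussProb (prec U)))
    (hdiff : ∀ B, χ U B ≠ 0 → ∀ g ∈ Metric.ball g₀ ε, HasDerivAt (fun g => P g U B + Q g U B) (e' g B) g)
    (hdiff' : ∀ B, χ U B ≠ 0 → ∀ g ∈ Metric.ball g₀ ε, HasDerivAt (fun g => e' g B) (e'' g B) g)
    (hdom : ∀ B, χ U B ≠ 0 → ∀ g ∈ Metric.ball g₀ ε, |P g U B + Q g U B| ≤ a₀ + α / 2 * (B ⬝ᵥ B))
    (hder : ∀ B, χ U B ≠ 0 → ∀ g ∈ Metric.ball g₀ ε, |e' g B| ≤ m₀ + m₂ / 2 * (B ⬝ᵥ B))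
    (hder2 : ∀ B, χ U B ≠ 0 → ∀ g ∈ Metric.ball g₀ ε, |e'' g B| ≤ n₀ + n₂ / 2 * (B ⬝ᵥ B))
    (hMα : (prec U - α • (1 : Matrix κ κ ℝ)).PosDef) (hMδ : (prec U - (α + δ) • (1 : Matrix κ κ ℝ)).PosDef)
    (hmass : 0 < ∫ B, χ U B * Real.exp (-(α / 2 * (B ⬝ᵥ B))) ∂(gaussProb (prec U))) :
    HasDerivAt (fun g => ((FluctData.gaussian prec hpd χ h0 h1 P Q).integral g U)⁻¹ *
          ∫ B, (FluctData.gaussian prec hpd χ h0 h1 P Q).integrand g U B * e' g B ∂(gaussProb (prec U)))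
        (((FluctData.gaussian prec hpd χ h0 h1 P Q).integral g₀ U)⁻¹ *
            ∫ B, (FluctData.gaussian prec hpd χ h0 h1 P Q).integrand g₀ U B * (e'' g₀ B + e' g₀ B ^ 2) ∂(gaussProb (prec U))
          - (((FluctData.gaussian prec hpd χ h0 h1 P Q).integral g₀ U)⁻¹ *
            ∫ B, (FluctData.gaussian prec hpd χ h0 h1 P Q).integrand g₀ U B * e' g₀ B ∂(gaussProb (prec U))) ^ 2) g₀ ∧
      |((FluctData.gaussian prec hpd χ h0 h1 P Q).integral g₀ U)⁻¹ *
            ∫ B, (FluctData.gaussian prec hpd χ h0 h1 P Q).integrand g₀ U B * (e'' g₀ B + e' g₀ B ^ 2) ∂(gaussProb (prec U))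
          - (((FluctData.gaussian prec hpd χ h0 h1 P Q).integral g₀ U)⁻¹ *
            ∫ B, (FluctData.gaussian prec hpd χ h0 h1 P Q).integrand g₀ U B * e' g₀ B ∂(gaussProb (prec U))) ^ 2|
        ≤ Real.exp (2 * a₀) * ((n₀ + 2 * m₀ ^ 2) * (Real.sqrt (prec U).det / Real.sqrt (prec U - α • (1 : Matrix κ κ ℝ)).det)
              + (n₂ / δ + 4 * m₂ ^ 2 / δ ^ 2)
                * (Real.sqrt (prec U).det / Real.sqrt (prec U - (α + δ) • (1 : Matrix κ κ ℝ)).det))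
            / ∫ B, χ U B * Real.exp (-(α / 2 * (B ⬝ᵥ B))) ∂(gaussProb (prec U))
          + (Real.exp (2 * a₀) * (m₀ * (Real.sqrt (prec U).det / Real.sqrt (prec U - α • (1 : Matrix κ κ ℝ)).det)
              + m₂ / δ * (Real.sqrt (prec U).det / Real.sqrt (prec U - (α + δ) • (1 : Matrix κ κ ℝ)).det))
            / ∫ B, χ U B * Real.exp (-(α / 2 * (B ⬝ᵥ B))) ∂(gaussProb (prec U))) ^ 2 := by
  set D := FluctData.gaussian prec hpd χ h0 h1 P Q with hD
  have hμ : D.μ U = gaussProb (prec U) := rfl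
  have hintg : ∀ g B, D.integrand g U B = χ U B * Real.exp (P g U B + Q g U B) := fun g B => rfl
  have hexp : ∀ g B, D.exponent g U B = P g U B + Q g U B := fun g B => rfl
  have hχD : ∀ B, D.χ U B = χ U B := fun B => rfl
  have hg₀ : g₀ ∈ Metric.ball g₀ ε := Metric.mem_ball_self hε
  -- abbreviations
  set Rα := Real.sqrt (prec U).det / Real.sqrt (prec U - α • (1 : Matrix κ κ ℝ)).det with hRα
  set Rδ := Real.sqrt (prec U).det / Real.sqrt (prec U - (α + δ) • (1 : Matrix κ κ ℝ)).det with hRδ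
  set mass := ∫ B, χ U B * Real.exp (-(α / 2 * (B ⬝ᵥ B))) ∂(gaussProb (prec U)) with hmass_def
  have hx : ∀ B : κ → ℝ, 0 ≤ B ⬝ᵥ B := fun B => Finset.sum_nonneg fun i _ => mul_self_nonneg (B i)
  -- the tilted density bound χ e^{F} ≤ e^{a₀} e^{½α|B|²} on the support
  have hF : ∀ B, χ U B ≠ 0 → ∀ g ∈ Metric.ball g₀ ε,
      χ U B * Real.exp (P g U B + Q g U B) ≤ Real.exp a₀ * Real.exp (α / 2 * (B ⬝ᵥ B)) := by
    intro B hB g hg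
    have hb := (abs_le.1 (hdom B hB g hg)).2
    calc χ U B * Real.exp (P g U B + Q g U B) ≤ 1 * Real.exp (a₀ + α / 2 * (B ⬝ᵥ B)) :=
          mul_le_mul (h1 U B) (Real.exp_le_exp.2 hb) (Real.exp_nonneg _) zero_le_one
      _ = Real.exp a₀ * Real.exp (α / 2 * (B ⬝ᵥ B)) := by rw [one_mul, Real.exp_add]
  -- the two majorants w₁ = m₀ + ½m₂x, w₂ = (n₀ + 2m₀²) + ½n₂x + (4m₂²/δ²)e^{½δx}  (x = |B|²)
  set w₁ : (κ → ℝ) → ℝ := fun B => m₀ + m₂ / 2 * (B ⬝ᵥ B) with hw₁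
  set w₂ : (κ → ℝ) → ℝ := fun B => (n₀ + 2 * m₀ ^ 2) + n₂ / 2 * (B ⬝ᵥ B)
    + 4 * m₂ ^ 2 / δ ^ 2 * Real.exp (δ / 2 * (B ⬝ᵥ B)) with hw₂
  have hw₁nn : ∀ B, 0 ≤ w₁ B := fun B => by simp only [hw₁]; have := hx B; positivity
  have hw₂nn : ∀ B, 0 ≤ w₂ B := fun B => by simp only [hw₂]; have := hx B; positivity
  have hw₁b : ∀ B, χ U B ≠ 0 → ∀ g ∈ Metric.ball g₀ ε, |e' g B| ≤ w₁ B := fun B hB g hg => hder B hB g hg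
  have hw₂b : ∀ B, χ U B ≠ 0 → ∀ g ∈ Metric.ball g₀ ε, |e'' g B + e' g B ^ 2| ≤ w₂ B := by
    intro B hB g hg
    have ha := hder2 B hB g hg
    have hb := hder B hB g hg
    have hsq : e' g B ^ 2 ≤ (m₀ + m₂ / 2 * (B ⬝ᵥ B)) ^ 2 := by
      rw [← sq_abs]; exact pow_le_pow_left₀ (abs_nonneg _) hb 2
    have hq := sq_sq_le_exp_sq (κ := κ) hδ B
    have hxB := hx B
    calc |e'' g B + e' g B ^ 2| ≤ |e'' g B| + |e' g B ^ 2| := abs_add_le _ _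
      _ ≤ (n₀ + n₂ / 2 * (B ⬝ᵥ B)) + (m₀ + m₂ / 2 * (B ⬝ᵥ B)) ^ 2 :=
          add_le_add ha (by rw [abs_of_nonneg (sq_nonneg _)]; exact hsq)
      _ ≤ (n₀ + n₂ / 2 * (B ⬝ᵥ B)) + (2 * m₀ ^ 2 + m₂ ^ 2 / 2 * (B ⬝ᵥ B) ^ 2) := by
          nlinarith [sq_nonneg (m₀ - m₂ / 2 * (B ⬝ᵥ B))]
      _ ≤ w₂ B := by
          have hm2 : 0 ≤ m₂ ^ 2 / 2 := by positivity
          have hq' : m₂ ^ 2 / 2 * (B ⬝ᵥ B) ^ 2 ≤ 4 * m₂ ^ 2 / δ ^ 2 * Real.exp (δ / 2 * (B ⬝ᵥ B)) :=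
            calc m₂ ^ 2 / 2 * (B ⬝ᵥ B) ^ 2 ≤ m₂ ^ 2 / 2 * (8 / δ ^ 2 * Real.exp (δ / 2 * (B ⬝ᵥ B))) :=
                  mul_le_mul_of_nonneg_left hq hm2
              _ = 4 * m₂ ^ 2 / δ ^ 2 * Real.exp (δ / 2 * (B ⬝ᵥ B)) := by ring
          simp only [hw₂]
          linarith [hq']
  -- the exponential dominations bound₁, bound₂ and their integrability
  set bound₁ : (κ → ℝ) → ℝ := fun B => Real.exp a₀ * (m₀ * Real.exp (α / 2 * (B ⬝ᵥ B))
      + m₂ / δ * Real.exp ((α + δ) / 2 * (B ⬝ᵥ B))) with hb₁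
  set bound₂ : (κ → ℝ) → ℝ := fun B => Real.exp a₀ * ((n₀ + 2 * m₀ ^ 2) * Real.exp (α / 2 * (B ⬝ᵥ B))
      + (n₂ / δ + 4 * m₂ ^ 2 / δ ^ 2) * Real.exp ((α + δ) / 2 * (B ⬝ᵥ B))) with hb₂
  have hb₁_int : Integrable bound₁ (D.μ U) := integrable_majorant₂ (hpd U) a₀ m₀ (m₂ / δ) hMα hMδ
  have hb₂_int : Integrable bound₂ (D.μ U) :=
    integrable_majorant₂ (hpd U) a₀ (n₀ + 2 * m₀ ^ 2) (n₂ / δ + 4 * m₂ ^ 2 / δ ^ 2) hMα hMδ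
  have heδ : ∀ B : κ → ℝ, Real.exp ((α + δ) / 2 * (B ⬝ᵥ B)) = Real.exp (α / 2 * (B ⬝ᵥ B)) * Real.exp (δ / 2 * (B ⬝ᵥ B)) :=
    fun B => by rw [← Real.exp_add]; ring_nf
  -- pointwise: e^{a₀}e^{½αx}·w₁ ≤ bound₁ and e^{a₀}e^{½αx}·w₂ ≤ bound₂
  have hw₁_le : ∀ B, Real.exp a₀ * Real.exp (α / 2 * (B ⬝ᵥ B)) * w₁ B ≤ bound₁ B := by
    intro B
    have hsq := sq_le_exp_sq'' (κ := κ) hδ B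
    have hE : 0 ≤ Real.exp a₀ * Real.exp (α / 2 * (B ⬝ᵥ B)) := by positivity
    have hm : w₁ B ≤ m₀ + m₂ / 2 * (2 / δ * Real.exp (δ / 2 * (B ⬝ᵥ B))) := by simp only [hw₁]; nlinarith
    calc Real.exp a₀ * Real.exp (α / 2 * (B ⬝ᵥ B)) * w₁ B
        ≤ Real.exp a₀ * Real.exp (α / 2 * (B ⬝ᵥ B)) * (m₀ + m₂ / 2 * (2 / δ * Real.exp (δ / 2 * (B ⬝ᵥ B)))) :=
          mul_le_mul_of_nonneg_left hm hE
      _ = bound₁ B := by simp only [hb₁, heδ]; ring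
  have hw₂_le : ∀ B, Real.exp a₀ * Real.exp (α / 2 * (B ⬝ᵥ B)) * w₂ B ≤ bound₂ B := by
    intro B
    have hsq := sq_le_exp_sq'' (κ := κ) hδ B
    have hE : 0 ≤ Real.exp a₀ * Real.exp (α / 2 * (B ⬝ᵥ B)) := by positivity
    have hm : w₂ B ≤ (n₀ + 2 * m₀ ^ 2) + n₂ / 2 * (2 / δ * Real.exp (δ / 2 * (B ⬝ᵥ B)))
        + 4 * m₂ ^ 2 / δ ^ 2 * Real.exp (δ / 2 * (B ⬝ᵥ B)) := by simp only [hw₂]; nlinarith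
    calc Real.exp a₀ * Real.exp (α / 2 * (B ⬝ᵥ B)) * w₂ B
        ≤ Real.exp a₀ * Real.exp (α / 2 * (B ⬝ᵥ B)) * ((n₀ + 2 * m₀ ^ 2) + n₂ / 2 * (2 / δ * Real.exp (δ / 2 * (B ⬝ᵥ B)))
            + 4 * m₂ ^ 2 / δ ^ 2 * Real.exp (δ / 2 * (B ⬝ᵥ B))) := mul_le_mul_of_nonneg_left hm hE
      _ = bound₂ B := by simp only [hb₂, heδ]; ring
  -- the dominations of the integrands on the support
  have hdom1 : ∀ B, D.χ U B ≠ 0 → ∀ g ∈ Metric.ball g₀ ε, |D.integrand g U B * e' g B| ≤ bound₁ B := by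
    intro B hB g hg
    rw [hintg, abs_mul, abs_of_nonneg (mul_nonneg (h0 U B) (Real.exp_nonneg _))]
    calc χ U B * Real.exp (P g U B + Q g U B) * |e' g B|
        ≤ (Real.exp a₀ * Real.exp (α / 2 * (B ⬝ᵥ B))) * w₁ B :=
          mul_le_mul (hF B hB g hg) (hw₁b B hB g hg) (abs_nonneg _) (by positivity)
      _ ≤ bound₁ B := hw₁_le B
  have hdom2 : ∀ B, D.χ U B ≠ 0 → ∀ g ∈ Metric.ball g₀ ε,
      |D.integrand g U B * (e'' g B + e' g B ^ 2)| ≤ bound₂ B := by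
    intro B hB g hg
    rw [hintg, abs_mul, abs_of_nonneg (mul_nonneg (h0 U B) (Real.exp_nonneg _))]
    calc χ U B * Real.exp (P g U B + Q g U B) * |e'' g B + e' g B ^ 2|
        ≤ (Real.exp a₀ * Real.exp (α / 2 * (B ⬝ᵥ B))) * w₂ B :=
          mul_le_mul (hF B hB g hg) (hw₂b B hB g hg) (abs_nonneg _) (by positivity)
      _ ≤ bound₂ B := hw₂_le B
  -- integrability of the integrand at g₀ and positivity of the integral
  have hint : Integrable (D.integrand g₀ U) (D.μ U) := by
    have hmajI : Integrable (fun B : κ → ℝ => Real.exp a₀ * Real.exp (α / 2 * (B ⬝ᵥ B))) (gaussProb (prec U)) := by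
      rw [integrable_gaussProb_iff (hpd U)]
      have h := (integrable_gaussWeight hMα).const_mul (Real.exp a₀)
      refine h.congr (Filter.Eventually.of_forall fun B => ?_)
      simp only [← gaussWeight_mul_exp_sq]
      ring
    refine hmajI.mono' (hmeas g₀ hg₀) (Filter.Eventually.of_forall fun B => ?_)
    rw [Real.norm_eq_abs, hintg, abs_of_nonneg (mul_nonneg (h0 U B) (Real.exp_nonneg _))]
    by_cases hB : χ U B = 0
    · rw [hB, zero_mul]; positivity
    · exact hF B hB g₀ hg₀
  have hintW : Integrable (fun B => gaussWeight (prec U) B * (χ U B * Real.exp (P g₀ U B + Q g₀ U B))) :=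
    (integrable_gaussProb_iff (hpd U) _).1 hint
  have hlow := integral_gaussian_ge_of_quadDom prec hpd χ h0 h1 P Q (fun B hB => hdom B hB g₀ hg₀) hintW
  have hpos : 0 < D.integral g₀ U := (mul_pos (Real.exp_pos _) hmass).trans_le hlow
  -- the variance formula
  have hderiv := hasDerivAt_derivNewTerm_of_dominated D e' e'' bound₁ bound₂ hε (fun g hg => hmeas g hg) hmeas' hmeas'' hint
    (fun B hB g hg => hdiff B hB g hg) (fun B hB g hg => hdiff' B hB g hg) hdom1 hdom2 hb₁_int hb₂_int hpos
  refine ⟨hderiv, ?_⟩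
  -- tilted integrability of the majorants
  have hcont₁ : Continuous w₁ := by simp only [hw₁]; fun_prop
  have hcont₂ : Continuous w₂ := by simp only [hw₂]; fun_prop
  have htint : ∀ (w : (κ → ℝ) → ℝ) (bd : (κ → ℝ) → ℝ), Continuous w → (∀ B, 0 ≤ w B) → Integrable bd (D.μ U) →
      (∀ B, Real.exp a₀ * Real.exp (α / 2 * (B ⬝ᵥ B)) * w B ≤ bd B) →
      Integrable (fun B => D.integrand g₀ U B * w B) (D.μ U) := by
    intro w bd hw hwnn hbd hle
    refine hbd.mono' ((hmeas g₀ hg₀).mul hw.aestronglyMeasurable) (Filter.Eventually.of_forall fun B => ?_)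
    rw [Real.norm_eq_abs, abs_of_nonneg (mul_nonneg (D.integrand_nonneg g₀ U B) (hwnn B)), hintg]
    by_cases hB : χ U B = 0
    · rw [hB, zero_mul, zero_mul]
      exact le_trans (mul_nonneg (by positivity) (hwnn B)) (hle B)
    · exact (mul_le_mul_of_nonneg_right (hF B hB g₀ hg₀) (hwnn B)).trans (hle B)
  have hI₁ := htint w₁ bound₁ hcont₁ hw₁nn hb₁_int hw₁_le
  have hI₂ := htint w₂ bound₂ hcont₂ hw₂nn hb₂_int hw₂_le
  have htilt := abs_secondDeriv_le_tilted D e' e'' w₁ w₂ (fun B hB => hw₁b B hB g₀ hg₀) (fun B hB => hw₂b B hB g₀ hg₀) hI₁ hI₂ hpos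
  -- the tilted moments of w₁ and w₂ by (2.25) at general precision
  have hnum₁ : ∫ B, D.integrand g₀ U B * w₁ B ∂(D.μ U) ≤ Real.exp a₀ * (m₀ * Rα + m₂ / δ * Rδ) :=
    tiltedQuadMoment_le_of_quadDom prec hpd χ h0 h1 P Q (g := g₀) (U := U) hm₀ hm₂ hδ (fun B hB => hdom B hB g₀ hg₀) hMα hMδ
  have hnum₂ : ∫ B, D.integrand g₀ U B * w₂ B ∂(D.μ U)
      ≤ Real.exp a₀ * ((n₀ + 2 * m₀ ^ 2) * Rα + (n₂ / δ + 4 * m₂ ^ 2 / δ ^ 2) * Rδ) := by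
    -- split w₂ = [(n₀ + 2m₀²) + ½n₂x] + (4m₂²/δ²)e^{½δx}
    have hqm := tiltedQuadMoment_le_of_quadDom prec hpd χ h0 h1 P Q (g := g₀) (U := U) (m₀ := n₀ + 2 * m₀ ^ 2) (m₂ := n₂)
      (by positivity) hn₂ hδ (fun B hB => hdom B hB g₀ hg₀) hMα hMδ
    have hem := tiltedExpMoment_le_of_quadDom prec hpd P Q (g := g₀) (U := U) (γ := δ) hδ.le
      (fun B => Real.sqrt (B ⬝ᵥ B)) (fun B => by rw [Real.sq_sqrt (hx B)]) χ h0 h1 (fun B hB => hdom B hB g₀ hg₀) hMδ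
    have hIa : Integrable (fun B => D.integrand g₀ U B * ((n₀ + 2 * m₀ ^ 2) + n₂ / 2 * (B ⬝ᵥ B))) (D.μ U) := by
      refine hI₂.mono' ((hmeas g₀ hg₀).mul (Continuous.aestronglyMeasurable (by fun_prop)))
        (Filter.Eventually.of_forall fun B => ?_)
      have hnn : 0 ≤ (n₀ + 2 * m₀ ^ 2) + n₂ / 2 * (B ⬝ᵥ B) := by have := hx B; positivity
      rw [Real.norm_eq_abs, abs_of_nonneg (mul_nonneg (D.integrand_nonneg g₀ U B) hnn)]
      refine mul_le_mul_of_nonneg_left ?_ (D.integrand_nonneg g₀ U B)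
      simp only [hw₂]
      have : 0 ≤ 4 * m₂ ^ 2 / δ ^ 2 * Real.exp (δ / 2 * (B ⬝ᵥ B)) := by positivity
      linarith
    have hIb : Integrable (fun B => D.integrand g₀ U B * (4 * m₂ ^ 2 / δ ^ 2 * Real.exp (δ / 2 * (B ⬝ᵥ B)))) (D.μ U) := by
      refine hI₂.mono' ((hmeas g₀ hg₀).mul (Continuous.aestronglyMeasurable (by fun_prop)))
        (Filter.Eventually.of_forall fun B => ?_)
      have hnn : 0 ≤ 4 * m₂ ^ 2 / δ ^ 2 * Real.exp (δ / 2 * (B ⬝ᵥ B)) := by positivity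
      rw [Real.norm_eq_abs, abs_of_nonneg (mul_nonneg (D.integrand_nonneg g₀ U B) hnn)]
      refine mul_le_mul_of_nonneg_left ?_ (D.integrand_nonneg g₀ U B)
      simp only [hw₂]
      have : 0 ≤ (n₀ + 2 * m₀ ^ 2) + n₂ / 2 * (B ⬝ᵥ B) := by have := hx B; positivity
      linarith
    have hsplit : ∫ B, D.integrand g₀ U B * w₂ B ∂(D.μ U)
        = ∫ B, D.integrand g₀ U B * ((n₀ + 2 * m₀ ^ 2) + n₂ / 2 * (B ⬝ᵥ B)) ∂(D.μ U)
          + ∫ B, D.integrand g₀ U B * (4 * m₂ ^ 2 / δ ^ 2 * Real.exp (δ / 2 * (B ⬝ᵥ B))) ∂(D.μ U) := by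
      rw [← integral_add hIa hIb]
      refine integral_congr_ae (Filter.Eventually.of_forall fun B => ?_)
      simp only [hw₂]; ring
    have hem' : ∫ B, D.integrand g₀ U B * (4 * m₂ ^ 2 / δ ^ 2 * Real.exp (δ / 2 * (B ⬝ᵥ B))) ∂(D.μ U)
        ≤ 4 * m₂ ^ 2 / δ ^ 2 * (Real.exp a₀ * Rδ) := by
      have e : ∫ B, D.integrand g₀ U B * (4 * m₂ ^ 2 / δ ^ 2 * Real.exp (δ / 2 * (B ⬝ᵥ B))) ∂(D.μ U)
          = 4 * m₂ ^ 2 / δ ^ 2 * ∫ B, χ U B * Real.exp (P g₀ U B + Q g₀ U B)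
              * Real.exp (δ / 2 * (Real.sqrt (B ⬝ᵥ B)) ^ 2) ∂(gaussProb (prec U)) := by
        rw [← integral_const_mul]
        refine integral_congr_ae (Filter.Eventually.of_forall fun B => ?_)
        show D.integrand g₀ U B * (4 * m₂ ^ 2 / δ ^ 2 * Real.exp (δ / 2 * (B ⬝ᵥ B)))
          = 4 * m₂ ^ 2 / δ ^ 2 * (χ U B * Real.exp (P g₀ U B + Q g₀ U B) * Real.exp (δ / 2 * Real.sqrt (B ⬝ᵥ B) ^ 2))
        rw [hintg, Real.sq_sqrt (hx B)]; ring
      rw [e]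
      exact mul_le_mul_of_nonneg_left hem (by positivity)
    have hqm' : ∫ B, D.integrand g₀ U B * ((n₀ + 2 * m₀ ^ 2) + n₂ / 2 * (B ⬝ᵥ B)) ∂(D.μ U)
        ≤ Real.exp a₀ * ((n₀ + 2 * m₀ ^ 2) * Rα + n₂ / δ * Rδ) := hqm
    rw [hsplit]
    have e2 : Real.exp a₀ * ((n₀ + 2 * m₀ ^ 2) * Rα + (n₂ / δ + 4 * m₂ ^ 2 / δ ^ 2) * Rδ)
        = Real.exp a₀ * ((n₀ + 2 * m₀ ^ 2) * Rα + n₂ / δ * Rδ) + 4 * m₂ ^ 2 / δ ^ 2 * (Real.exp a₀ * Rδ) := by ring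
    rw [e2]
    exact add_le_add hqm' hem'
  -- 1/I ≤ e^{a₀}/mass and assembly
  have hinv : (D.integral g₀ U)⁻¹ ≤ Real.exp a₀ / mass := by
    rw [inv_le_comm₀ hpos (div_pos (Real.exp_pos _) hmass), inv_div]
    calc mass / Real.exp a₀ = Real.exp (-a₀) * mass := by rw [Real.exp_neg, div_eq_inv_mul]
      _ ≤ D.integral g₀ U := hlow
  have hinv0 : 0 ≤ (D.integral g₀ U)⁻¹ := inv_nonneg.2 hpos.le
  have hn₁0 : 0 ≤ ∫ B, D.integrand g₀ U B * w₁ B ∂(D.μ U) :=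
    integral_nonneg fun B => mul_nonneg (D.integrand_nonneg g₀ U B) (hw₁nn B)
  have hn₂0 : 0 ≤ ∫ B, D.integrand g₀ U B * w₂ B ∂(D.μ U) :=
    integral_nonneg fun B => mul_nonneg (D.integrand_nonneg g₀ U B) (hw₂nn B)
  have hK₁0 : 0 ≤ Real.exp a₀ * (m₀ * Rα + m₂ / δ * Rδ) := le_trans hn₁0 hnum₁
  have hK₂0 : 0 ≤ Real.exp a₀ * ((n₀ + 2 * m₀ ^ 2) * Rα + (n₂ / δ + 4 * m₂ ^ 2 / δ ^ 2) * Rδ) := le_trans hn₂0 hnum₂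
  have hA : (D.integral g₀ U)⁻¹ * ∫ B, D.integrand g₀ U B * w₂ B ∂(D.μ U)
      ≤ Real.exp (2 * a₀) * ((n₀ + 2 * m₀ ^ 2) * Rα + (n₂ / δ + 4 * m₂ ^ 2 / δ ^ 2) * Rδ) / mass := by
    calc (D.integral g₀ U)⁻¹ * ∫ B, D.integrand g₀ U B * w₂ B ∂(D.μ U)
        ≤ (Real.exp a₀ / mass) * (Real.exp a₀ * ((n₀ + 2 * m₀ ^ 2) * Rα + (n₂ / δ + 4 * m₂ ^ 2 / δ ^ 2) * Rδ)) :=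
          mul_le_mul hinv hnum₂ hn₂0 (div_nonneg (Real.exp_nonneg _) hmass.le)
      _ = _ := by rw [show (2 : ℝ) * a₀ = a₀ + a₀ by ring, Real.exp_add]; ring
  have hC : (D.integral g₀ U)⁻¹ * ∫ B, D.integrand g₀ U B * w₁ B ∂(D.μ U)
      ≤ Real.exp (2 * a₀) * (m₀ * Rα + m₂ / δ * Rδ) / mass := by
    calc (D.integral g₀ U)⁻¹ * ∫ B, D.integrand g₀ U B * w₁ B ∂(D.μ U)
        ≤ (Real.exp a₀ / mass) * (Real.exp a₀ * (m₀ * Rα + m₂ / δ * Rδ)) :=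
          mul_le_mul hinv hnum₁ hn₁0 (div_nonneg (Real.exp_nonneg _) hmass.le)
      _ = _ := by rw [show (2 : ℝ) * a₀ = a₀ + a₀ by ring, Real.exp_add]; ring
  have hC0 : 0 ≤ (D.integral g₀ U)⁻¹ * ∫ B, D.integrand g₀ U B * w₁ B ∂(D.μ U) := mul_nonneg hinv0 hn₁0
  have hC2 : ((D.integral g₀ U)⁻¹ * ∫ B, D.integrand g₀ U B * w₁ B ∂(D.μ U)) ^ 2
      ≤ (Real.exp (2 * a₀) * (m₀ * Rα + m₂ / δ * Rδ) / mass) ^ 2 := pow_le_pow_left₀ hC0 hC 2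
  exact htilt.trans (add_le_add hA hC2)

end Gaussian

/-! ## §2 (v1.1). The second-DIFFERENCE letter (B2) with a Gaussian modulus -/

section GaussianSecondDifference

variable {X : Type*} {κ : Type} [Fintype κ] [DecidableEq κ]
variable (prec : X → Matrix κ κ ℝ) (hpd : ∀ U, (prec U).PosDef) (χ : X → (κ → ℝ) → ℝ) (h0 : ∀ U B, 0 ≤ χ U B)
  (h1 : ∀ U B, χ U B ≤ 1) (P Q : ℝ → X → (κ → ℝ) → ℝ)

omit [Fintype κ] [DecidableEq κ] in
/-- **TAYLOR AT SECOND ORDER, DIFFERENCE FORM**: if `f` has the derivative `f′ x` at every point `x` of a convex `S ∋ t − d, t + d`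
(`0 ≤ d`) and `f′` is `K`-Lipschitz on `S`, then `|f(t + d) − 2f(t) + f(t − d)| ≤ K·d²` (mean value on `s ↦ f(t + s) − f(t − d + s)`,
`s ∈ [0, d]`; twin of the private lemma of `B12Eq213SecondOrderCoupling` §5). [folklore] -/
private theorem abs_secondDiff_le_of_lipschitz_deriv {f f' : ℝ → ℝ} {S : Set ℝ} {K t d : ℝ} (hS : Convex ℝ S) (hd : 0 ≤ d)
    (htm : t - d ∈ S) (htp : t + d ∈ S) (hf : ∀ x ∈ S, HasDerivAt f (f' x) x)
    (hK : ∀ x ∈ S, ∀ y ∈ S, |f' x - f' y| ≤ K * |x - y|) :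
    |f (t + d) - 2 * f t + f (t - d)| ≤ K * d ^ 2 := by
  have hseg : Set.Icc (t - d) (t + d) ⊆ S := (convex_iff_ordConnected.1 hS).out htm htp
  have hφ : ∀ s ∈ Set.Icc (0 : ℝ) d,
      HasDerivWithinAt (fun s => f (t + s) - f (t - d + s)) (f' (t + s) - f' (t - d + s)) (Set.Icc (0 : ℝ) d) s := by
    intro s hs
    have h1 : HasDerivAt (fun s => f (t + s)) (f' (t + s)) s :=
      HasDerivAt.comp_const_add t s (hf _ (hseg ⟨by linarith [hs.1], by linarith [hs.2]⟩))
    have h2 : HasDerivAt (fun s => f (t - d + s)) (f' (t - d + s)) s :=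
      HasDerivAt.comp_const_add (t - d) s (hf _ (hseg ⟨by linarith [hs.1], by linarith [hs.2]⟩))
    exact (h1.sub h2).hasDerivWithinAt
  have hbound : ∀ s ∈ Set.Ico (0 : ℝ) d, ‖f' (t + s) - f' (t - d + s)‖ ≤ K * d := by
    intro s hs
    have h := hK (t + s) (hseg ⟨by linarith [hs.1], by linarith [hs.2]⟩) (t - d + s) (hseg ⟨by linarith [hs.1], by linarith [hs.2]⟩)
    rw [show t + s - (t - d + s) = d by ring, abs_of_nonneg hd] at h
    rwa [Real.norm_eq_abs]
  have hmv := norm_image_sub_le_of_norm_deriv_le_segment' hφ hbound d (Set.right_mem_Icc.2 hd)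
  rw [Real.norm_eq_abs] at hmv
  have e : f (t + d) - f (t - d + d) - (f (t + 0) - f (t - d + 0)) = f (t + d) - 2 * f t + f (t - d) := by
    rw [sub_add_cancel, add_zero, add_zero]; ring
  rw [e] at hmv
  calc |f (t + d) - 2 * f t + f (t - d)| ≤ K * d * (d - 0) := hmv
    _ = K * d ^ 2 := by ring

/-- **(B2) WITH A GAUSSIAN MODULUS — p. 263's CLAUSE AT SECOND ORDER IN DIFFERENCE FORM.**  At the Gaussian datum of (2.13), on a coupling
ball `|g − c| < ρ` along which the exponent `F = 𝐏^{(k)} + {…}` is twice `g`-differentiable on the small-field support with the (2.20)-type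
dominations `|F| ≤ a₀ + ½α|B|²`, `|∂_gF| ≤ m₀ + ½m₂|B|²`, `|∂²_gF| ≤ n₀ + ½n₂|B|²` (`m₀, m₂, n₀, n₂ ≥ 0`, `δ > 0`), `M − α·1`, `M − (α+δ)·1`
positive definite (`M = prec U`), positive damped small-field mass, measurable integrands ∕ derivatives: for `t − d, t + d` in the ball
(`0 ≤ d`), with `R(c) = √(det M ∕ det(M − c·1))` and `mass = ∫ χ_U e^{−½α|B|²} dμ_{M⁻¹}`,
`|𝐄^{(k+1)}(t+d, U) − 2𝐄^{(k+1)}(t, U) + 𝐄^{(k+1)}(t−d, U)| ≤ K·d²`,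
`K = e^{2a₀}((n₀ + 2m₀²)R(α) + (n₂∕δ + 4m₂²∕δ²)R(α+δ))∕mass + (e^{2a₀}(m₀R(α) + (m₂∕δ)R(α+δ))∕mass)²` — §1's second-derivative bound, uniform
on the ball, passed through the mean value theorem twice. [cite: Balaban1987RG1, (2.13) p.268, p.263 (clause before (1.18)) and p.264; Balaban1988RG2Cluster, (2.20) p.16 and (2.25) p.17] -/
theorem abs_secondDiff_newTerm_gaussian_le {U : X} {c ρ a₀ α δ m₀ m₂ n₀ n₂ : ℝ} (e' e'' : ℝ → (κ → ℝ) → ℝ)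
    (hm₀ : 0 ≤ m₀) (hm₂ : 0 ≤ m₂) (hn₀ : 0 ≤ n₀) (hn₂ : 0 ≤ n₂) (hδ : 0 < δ)
    (hmeas : ∀ g ∈ Metric.ball c ρ,
      AEStronglyMeasurable (fun B => χ U B * Real.exp (P g U B + Q g U B)) (gaussProb (prec U)))
    (hmeas' : ∀ g ∈ Metric.ball c ρ, AEStronglyMeasurable (e' g) (gaussProb (prec U)))
    (hmeas'' : ∀ g ∈ Metric.ball c ρ, AEStronglyMeasurable (e'' g) (gaussProb (prec U)))
    (hdiff : ∀ B, χ U B ≠ 0 → ∀ g ∈ Metric.ball c ρ, HasDerivAt (fun g => P g U B + Q g U B) (e' g B) g)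
    (hdiff' : ∀ B, χ U B ≠ 0 → ∀ g ∈ Metric.ball c ρ, HasDerivAt (fun g => e' g B) (e'' g B) g)
    (hdom : ∀ B, χ U B ≠ 0 → ∀ g ∈ Metric.ball c ρ, |P g U B + Q g U B| ≤ a₀ + α / 2 * (B ⬝ᵥ B))
    (hder : ∀ B, χ U B ≠ 0 → ∀ g ∈ Metric.ball c ρ, |e' g B| ≤ m₀ + m₂ / 2 * (B ⬝ᵥ B))
    (hder2 : ∀ B, χ U B ≠ 0 → ∀ g ∈ Metric.ball c ρ, |e'' g B| ≤ n₀ + n₂ / 2 * (B ⬝ᵥ B))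
    (hMα : (prec U - α • (1 : Matrix κ κ ℝ)).PosDef) (hMδ : (prec U - (α + δ) • (1 : Matrix κ κ ℝ)).PosDef)
    (hmass : 0 < ∫ B, χ U B * Real.exp (-(α / 2 * (B ⬝ᵥ B))) ∂(gaussProb (prec U)))
    {t d : ℝ} (hd : 0 ≤ d) (htm : t - d ∈ Metric.ball c ρ) (htp : t + d ∈ Metric.ball c ρ) :
    |(FluctData.gaussian prec hpd χ h0 h1 P Q).newTerm (t + d) U - 2 * (FluctData.gaussian prec hpd χ h0 h1 P Q).newTerm t U
        + (FluctData.gaussian prec hpd χ h0 h1 P Q).newTerm (t - d) U|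
      ≤ (Real.exp (2 * a₀) * ((n₀ + 2 * m₀ ^ 2) * (Real.sqrt (prec U).det / Real.sqrt (prec U - α • (1 : Matrix κ κ ℝ)).det)
              + (n₂ / δ + 4 * m₂ ^ 2 / δ ^ 2)
                * (Real.sqrt (prec U).det / Real.sqrt (prec U - (α + δ) • (1 : Matrix κ κ ℝ)).det))
            / ∫ B, χ U B * Real.exp (-(α / 2 * (B ⬝ᵥ B))) ∂(gaussProb (prec U))
          + (Real.exp (2 * a₀) * (m₀ * (Real.sqrt (prec U).det / Real.sqrt (prec U - α • (1 : Matrix κ κ ℝ)).det)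
              + m₂ / δ * (Real.sqrt (prec U).det / Real.sqrt (prec U - (α + δ) • (1 : Matrix κ κ ℝ)).det))
            / ∫ B, χ U B * Real.exp (-(α / 2 * (B ⬝ᵥ B))) ∂(gaussProb (prec U))) ^ 2) * d ^ 2 := by
  set D := FluctData.gaussian prec hpd χ h0 h1 P Q with hD
  -- abbreviations for the constant
  set K := Real.exp (2 * a₀) * ((n₀ + 2 * m₀ ^ 2) * (Real.sqrt (prec U).det / Real.sqrt (prec U - α • (1 : Matrix κ κ ℝ)).det)
              + (n₂ / δ + 4 * m₂ ^ 2 / δ ^ 2)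
                * (Real.sqrt (prec U).det / Real.sqrt (prec U - (α + δ) • (1 : Matrix κ κ ℝ)).det))
            / ∫ B, χ U B * Real.exp (-(α / 2 * (B ⬝ᵥ B))) ∂(gaussProb (prec U))
          + (Real.exp (2 * a₀) * (m₀ * (Real.sqrt (prec U).det / Real.sqrt (prec U - α • (1 : Matrix κ κ ℝ)).det)
              + m₂ / δ * (Real.sqrt (prec U).det / Real.sqrt (prec U - (α + δ) • (1 : Matrix κ κ ℝ)).det))
            / ∫ B, χ U B * Real.exp (-(α / 2 * (B ⬝ᵥ B))) ∂(gaussProb (prec U))) ^ 2 with hK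
  -- sub-balls
  have hsub : ∀ g₀ ∈ Metric.ball c ρ, 0 < ρ - dist g₀ c ∧ Metric.ball g₀ (ρ - dist g₀ c) ⊆ Metric.ball c ρ := fun g₀ hg₀ =>
    ⟨sub_pos.2 (Metric.mem_ball.1 hg₀), Metric.ball_subset_ball' (by linarith)⟩
  -- the new term is differentiable on the ball (module 5), derivative `E′`
  have hder1 : ∀ g₀ ∈ Metric.ball c ρ, HasDerivAt (fun g => D.newTerm g U)
      ((D.integral g₀ U)⁻¹ * ∫ B, D.integrand g₀ U B * e' g₀ B ∂(gaussProb (prec U))) g₀ := by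
    intro g₀ hg₀
    obtain ⟨hε, hball⟩ := hsub g₀ hg₀
    exact (hasDerivAt_newTerm_gaussian_of_quadDom prec hpd χ h0 h1 P Q e' hε hm₀ hm₂ hδ (fun g hg => hmeas g (hball hg))
      (hmeas' g₀ hg₀) (fun B hB g hg => hdiff B hB g (hball hg)) (fun B hB g hg => hdom B hB g (hball hg))
      (fun B hB g hg => hder B hB g (hball hg)) hMα hMδ hmass).1
  -- its derivative `E′` is differentiable with `|E″| ≤ K` at every point of the ball (§1), hence `K`-Lipschitz
  have hder2' : ∀ g₀ ∈ Metric.ball c ρ, ∃ v : ℝ,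
      HasDerivAt (fun g => (D.integral g U)⁻¹ * ∫ B, D.integrand g U B * e' g B ∂(gaussProb (prec U))) v g₀ ∧ |v| ≤ K := by
    intro g₀ hg₀
    obtain ⟨hε, hball⟩ := hsub g₀ hg₀
    have h := abs_secondDeriv_newTerm_gaussian_le prec hpd χ h0 h1 P Q e' e'' hε hm₀ hm₂ hn₀ hn₂ hδ
      (fun g hg => hmeas g (hball hg)) (fun g hg => hmeas' g (hball hg)) (hmeas'' g₀ hg₀)
      (fun B hB g hg => hdiff B hB g (hball hg)) (fun B hB g hg => hdiff' B hB g (hball hg))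
      (fun B hB g hg => hdom B hB g (hball hg)) (fun B hB g hg => hder B hB g (hball hg))
      (fun B hB g hg => hder2 B hB g (hball hg)) hMα hMδ hmass
    exact ⟨_, h.1, h.2⟩
  choose! v hv using hder2'
  have hlip : ∀ x ∈ Metric.ball c ρ, ∀ y ∈ Metric.ball c ρ,
      |(D.integral x U)⁻¹ * ∫ B, D.integrand x U B * e' x B ∂(gaussProb (prec U))
        - (D.integral y U)⁻¹ * ∫ B, D.integrand y U B * e' y B ∂(gaussProb (prec U))| ≤ K * |x - y| := by
    intro x hx y hy
    have key := Convex.norm_image_sub_le_of_norm_hasDerivWithin_le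
      (f := fun g => (D.integral g U)⁻¹ * ∫ B, D.integrand g U B * e' g B ∂(gaussProb (prec U))) (f' := v) (s := Metric.ball c ρ)
      (fun z hz => (hv z hz).1.hasDerivWithinAt) (fun z hz => by simpa [Real.norm_eq_abs] using (hv z hz).2)
      (convex_ball c ρ) hy hx
    simpa [Real.norm_eq_abs] using key
  exact abs_secondDiff_le_of_lipschitz_deriv (f := fun g => D.newTerm g U)
    (f' := fun g => (D.integral g U)⁻¹ * ∫ B, D.integrand g U B * e' g B ∂(gaussProb (prec U))) (convex_ball c ρ) hd htm htp hder1 hlip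

end GaussianSecondDifference

end Literature.MathematicalPhysics.QuantumFieldTheory.Balaban1983to89.B12Eq213GaussianSecondOrder
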